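import Summits.AnomalousDissipation.AnomalousDissipation.Theorems.SolenoidalFractalHomogenisationLagrangianStepOneLevelDefsSectorial
import HarnessLib

/-!
# K1L `LagrangianRenormalisationStep(Design)` (stmt-AnomalousDissipation-24912 → K1L_D): the (V)-clause cuts for the ν-dependent shape FAMILY —
# ellipticity of the effective tensor, Lions existence, and the adapters «(V_ν) without existence ⇒ (V_ν)» from the interval / sectorial-interval
# window clauses (helper; `--supports … --as helper`; LANDING LIST F2)

Summits-side helper file of route `SolenoidalFractalHomogenisation` (two definitions — the family slow-vector clauses `SlowVectorClauseF` /
`SlowVectorClauseNoExF`, p1 tenure D24-1 texts — and proved consumer facts; no named facts, no sorry).  Landing item F2 of the tenure planner's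
LANDING MAP (cell `ad-ideate`, tenure D24-2 (c) / D24-3, STATUS 2026-08-28T13:04:46Z) for the crux workfile
`Cruxes/LagrangianRenormalisationStep/IntervalWindowFamilySketch.lean` (planner ad-ideate-p4 g9, commit 78e41dd75007, farm rc 0): §4
(`SlowVectorClauseF`, `SlowVectorClauseNoExF`, `nearIso_effTensorI`, `exists_effective_singleModeI`, `slowVectorClauseF_of_noExF_interval`) and the §7
sectorial × defect versions (`nearIso_effTensorIS`, `exists_effective_singleModeIS`, `slowVectorClauseF_of_noExF_intervalS` / `_familyS`), texts copied
VERBATIM into the shared namespace `…Theorems.SolenoidalFractalHomogenisation.LagrangianStep` (cf. the constant-`Φ` precedent `…LagrangianStepCellClauseCuts`,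
p629134: `nearIso_effTensor`, `exists_effective_singleMode`, `slowVectorClause_of_noEx`).

CONTENT.  For `𝔸` in the `ν`-scaled clause interval the effective cell tensor `(1/n²)•(𝔸 + (c/ν)•Φν((1/ν)•𝔸))` is elliptic with an explicit lower
constant (interval clause ⇒ `NearIso` of the image via the currency conversions of F1), so J.-L. Lions' carrier-free theorem
(`Torus.exists_isWeakTensorPassiveVectorOn_zero_carrier`, Literature `PassiveVectorTensorLionsExistence`) supplies the effective single-mode solution
whose existence the v20 cut removed from the (V) clause; the adapters restore the full clause under the COMPATIBILITY inequalities
`ΛV·shi ≤ Λ'·lo`, `ΛV·hi ≤ Λ'·slo`, `Λ' ∈ [λ₀, Λ]` (the (V) `NearIso` window sits inside ONE clause interval).  Infrastructure for route-1's rung leaf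
F-D1.A0 (a frontier FORMAL rung); NOT a proof of the crux, of Onsager's conjecture or of anomalous dissipation.  Landed by prover seat
`ad-k3l-bookkeeping-p1` g3, 2026-08-28.
-/

set_option linter.dupNamespace false

namespace Summit.AnomalousDissipation.AnomalousDissipation.Theorems.SolenoidalFractalHomogenisation.LagrangianStep

open Literature.Analysis Literature.Analysis.FluidPDE Literature.Analysis.FunctionSpaces
open MeasureTheory Set Filter
open scoped ENNReal NNReal InnerProductSpace
open Summit.AnomalousDissipation.AnomalousDissipation.Theorems.SolenoidalFractalHomogenisation.RealisedQuasiStaticCellLaw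
  (memLp_two_of_memSobolev_one_complexify memSobolev_one_singleMode isWeaklyDivFree_singleMode)

noncomputable section

/-! ## §4 The family slow-vector clauses and their cuts (interval window) -/

/-- [VERBATIM p1 r24 F1(c)] (V) for a ν-DEPENDENT shape map. -/
def SlowVectorClauseF {k : ℕ} (W : LatticeShear.LatticeWord k) (M : ℝ) (hM : 0 < M) (c : ℝ)
    (Φ : ℝ → Torus.Visc4 (Fin 3) → Torus.Visc4 (Fin 3)) (lo hi Λ β σ C ν₀ K : ℝ) : Prop :=
      ∀ ν, ∀ hν : ν ∈ Set.Ioo 0 ν₀, ∀ n : ℕ, ∀ 𝔸 : Torus.Visc4 (Fin 3),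
        Torus.OddSmall 𝔸 (ν * β) → (∃ lam ∈ Set.Icc (1:ℝ) Λ, Torus.NearIso 𝔸 (ν * (lo / lam)) (ν * (hi * lam))) →
        ∀ ℓ : Fin 3 → ℤ, ℓ ≠ 0 → ‖Torus.latticeVec ℓ‖ * (⌈K / ν⌉₊ : ℝ) ≤ n →
        ∀ p : EuclideanSpace ℝ (Fin 3), ‖p‖ = 1 → ⟪p, Torus.latticeVec ℓ⟫_ℝ = 0 →
        ∀ T > (0:ℝ),
          (∃ v : ℝ → VF, Torus.IsWeakTensorPassiveVectorOn 0 (2 * T) ((1 / (n:ℝ) ^ 2) • (𝔸 + (c / ν) • Φ ν ((1 / ν) • 𝔸))) (fun _ _ => 0)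
                (fun x => (UnitAddTorus.mFourier ℓ x).re • p) v) ∧
          ∀ w v : ℝ → VF,
            Torus.IsWeakTensorPassiveVectorOn 0 T ((1 / (n:ℝ) ^ 2) • 𝔸) (cellField W M hM ν hν.1 n) (fun x => (UnitAddTorus.mFourier ℓ x).re • p) w →
            Torus.IsWeakTensorPassiveVectorOn 0 (2 * T) ((1 / (n:ℝ) ^ 2) • (𝔸 + (c / ν) • Φ ν ((1 / ν) • 𝔸))) (fun _ _ => 0)
                (fun x => (UnitAddTorus.mFourier ℓ x).re • p) v →
            ∀ᵐ t ∂(volume.restrict (Ioo 0 T)),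
              2 * ∑ i, ‖modeCoeff ℓ (fun x => w t x - v t x) i‖ ^ 2
                  ≤ (C * (C * (ν ^ σ + (‖Torus.latticeVec ℓ‖ * (⌈K / ν⌉₊ : ℝ) / n) ^ σ) * min 1 ((8 * Real.pi ^ 2 * ‖Torus.latticeVec ℓ‖ ^ 2 * (hi * Λ) * (ν + c / ν) / (n:ℝ) ^ 2) * t) + (8 * Real.pi ^ 2 * ‖Torus.latticeVec ℓ‖ ^ 2 * (hi * Λ) * (ν + c / ν) / (n:ℝ) ^ 2) * (M * W.period / ν))) ^ 2
                      * ∫ x, ‖(UnitAddTorus.mFourier ℓ x).re • p‖ ^ 2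

/-- [VERBATIM p1 r24 F2(a)] (V) for the family WITHOUT its existence conjunct. -/
def SlowVectorClauseNoExF {k : ℕ} (W : LatticeShear.LatticeWord k) (M : ℝ) (hM : 0 < M) (c : ℝ)
    (Φ : ℝ → Torus.Visc4 (Fin 3) → Torus.Visc4 (Fin 3)) (lo hi Λ β σ C ν₀ K : ℝ) : Prop :=
      ∀ ν, ∀ hν : ν ∈ Set.Ioo 0 ν₀, ∀ n : ℕ, ∀ 𝔸 : Torus.Visc4 (Fin 3),
        Torus.OddSmall 𝔸 (ν * β) → (∃ lam ∈ Set.Icc (1:ℝ) Λ, Torus.NearIso 𝔸 (ν * (lo / lam)) (ν * (hi * lam))) →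
        ∀ ℓ : Fin 3 → ℤ, ℓ ≠ 0 → ‖Torus.latticeVec ℓ‖ * (⌈K / ν⌉₊ : ℝ) ≤ n →
        ∀ p : EuclideanSpace ℝ (Fin 3), ‖p‖ = 1 → ⟪p, Torus.latticeVec ℓ⟫_ℝ = 0 →
        ∀ T > (0:ℝ),
          ∀ w v : ℝ → VF,
            Torus.IsWeakTensorPassiveVectorOn 0 T ((1 / (n:ℝ) ^ 2) • 𝔸) (cellField W M hM ν hν.1 n) (fun x => (UnitAddTorus.mFourier ℓ x).re • p) w →
            Torus.IsWeakTensorPassiveVectorOn 0 (2 * T) ((1 / (n:ℝ) ^ 2) • (𝔸 + (c / ν) • Φ ν ((1 / ν) • 𝔸))) (fun _ _ => 0)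
                (fun x => (UnitAddTorus.mFourier ℓ x).re • p) v →
            ∀ᵐ t ∂(volume.restrict (Ioo 0 T)),
              2 * ∑ i, ‖modeCoeff ℓ (fun x => w t x - v t x) i‖ ^ 2
                  ≤ (C * (C * (ν ^ σ + (‖Torus.latticeVec ℓ‖ * (⌈K / ν⌉₊ : ℝ) / n) ^ σ) * min 1 ((8 * Real.pi ^ 2 * ‖Torus.latticeVec ℓ‖ ^ 2 * (hi * Λ) * (ν + c / ν) / (n:ℝ) ^ 2) * t) + (8 * Real.pi ^ 2 * ‖Torus.latticeVec ℓ‖ ^ 2 * (hi * Λ) * (ν + c / ν) / (n:ℝ) ^ 2) * (M * W.period / ν))) ^ 2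
                      * ∫ x, ‖(UnitAddTorus.mFourier ℓ x).re • p‖ ^ 2

/-- **CONSUMER FACT 2 (F2): ellipticity of the effective tensor from the interval clause.**  For `(1/ν)•𝔸` in the guarded interval of aspect
`λ ∈ [λ₀, Λ]`, the effective cell tensor `(1/n²)•(𝔸 + (c/ν)•Φν((1/ν)•𝔸))` is `NearIso` with the positive lower constant `(1/n²)(ν + c/ν)·slo/(μλ)`. -/
theorem nearIso_effTensorI {Φν : T4 → T4} {Sstar : T4} {slo shi lam₀ Λ β μ : ℝ}
    (hwin : IntervalWindowClause Φν Sstar slo shi lam₀ Λ β μ) (hμ : 1 ≤ μ) (hslo : 0 ≤ slo)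
    {ν c : ℝ} (hν : 0 < ν) (hc : 0 ≤ c) {n : ℕ} {𝔸 : T4} (hodd : Torus.OddSmall 𝔸 (ν * β))
    {lam : ℝ} (hlam : lam ∈ Set.Icc lam₀ Λ) (hA : InInterval Sstar lam ((1 / ν) • 𝔸)) :
    Torus.NearIso ((1 / (n:ℝ) ^ 2) • (𝔸 + (c / ν) • Φν ((1 / ν) • 𝔸)))
      ((1 / (n:ℝ) ^ 2) * ((ν + c / ν) * (slo / (μ * lam)))) ((1 / (n:ℝ) ^ 2) * ((ν + c / ν) * (shi * (μ * lam)))) := by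
  obtain ⟨hstar, hlam₀, _, hstep⟩ := hwin
  have hlam1 : 1 ≤ lam := le_trans hlam₀ hlam.1
  have hlampos : 0 < lam := lt_of_lt_of_le one_pos hlam1
  have hμlam : 1 ≤ μ * lam := one_le_mul_of_one_le_of_one_le hμ hlam1
  have hle : lam ≤ μ * lam := le_mul_of_one_le_left hlampos.le hμ
  have hodd' : Torus.OddSmall ((1 / ν) • 𝔸) β := by
    have h := hodd.smul (1 / ν)
    exact oddSmall_congr h (by field_simp)
  obtain ⟨_, hΦi⟩ := hstep lam hlam _ hodd' hA
  have hpos : TransNonneg Sstar := transNonneg_of_nearIso hstar hslo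
  have hX : Torus.NearIso ((1 / ν) • 𝔸) (slo / (μ * lam)) (shi * (μ * lam)) :=
    InInterval.nearIso hμlam hstar (hA.mono hpos hlampos hle)
  have hΦ : Torus.NearIso (Φν ((1 / ν) • 𝔸)) (slo / (μ * lam)) (shi * (μ * lam)) := InInterval.nearIso hμlam hstar hΦi
  have hA𝔸 : Torus.NearIso 𝔸 (ν * (slo / (μ * lam))) (ν * (shi * (μ * lam))) := by
    have h := hX.smul (c := ν) hν.le
    rwa [smul_smul, mul_one_div_cancel hν.ne', one_smul] at h
  have hcν : 0 ≤ c / ν := div_nonneg hc hν.le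
  have hsum := hA𝔸.add (hΦ.smul hcν)
  have hn : (0:ℝ) ≤ 1 / (n:ℝ) ^ 2 := by positivity
  have h := hsum.smul hn
  exact nearIso_congr h (by ring) (by ring)

/-- **Existence of the effective single-mode solution for the family** from the interval clause (Lions), with the (V)-text window hypothesis in
`NearIso` currency and the explicit compatibility inequalities `ΛV·shi ≤ Λ'·lo`, `ΛV·hi ≤ Λ'·slo`, `Λ' ∈ [λ₀, Λ]`.
[cite: LionsMagenes1972, Chap. 3 Thm. 1.1] -/
theorem exists_effective_singleModeI {Φν : T4 → T4} {Sstar : T4} {slo shi lam₀ Λ β μ : ℝ}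
    (hwin : IntervalWindowClause Φν Sstar slo shi lam₀ Λ β μ) (hμ : 1 ≤ μ) (hslo : 0 < slo)
    {lo hi ΛV Λ' : ℝ} (hlo : 0 < lo) (hhi : 0 ≤ hi) (hΛ' : Λ' ∈ Set.Icc lam₀ Λ)
    (hc1 : ΛV * shi ≤ Λ' * lo) (hc2 : ΛV * hi ≤ Λ' * slo)
    {ν c K : ℝ} (hν : 0 < ν) (hc : 0 ≤ c) (hK : 0 < K) {n : ℕ}
    {𝔸 : T4} (hodd : Torus.OddSmall 𝔸 (ν * β))
    (hwin' : ∃ lam ∈ Set.Icc (1:ℝ) ΛV, Torus.NearIso 𝔸 (ν * (lo / lam)) (ν * (hi * lam)))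
    {ℓ : Fin 3 → ℤ} (hℓ : ℓ ≠ 0) (hsep : ‖Torus.latticeVec ℓ‖ * (⌈K / ν⌉₊ : ℝ) ≤ n)
    {p : EuclideanSpace ℝ (Fin 3)} (hperp : ⟪p, Torus.latticeVec ℓ⟫_ℝ = 0) {T : ℝ} (hT : 0 < T) :
    ∃ v : ℝ → VF, Torus.IsWeakTensorPassiveVectorOn 0 (2 * T) ((1 / (n:ℝ) ^ 2) • (𝔸 + (c / ν) • Φν ((1 / ν) • 𝔸))) (fun _ _ => 0)
      (fun x => (UnitAddTorus.mFourier ℓ x).re • p) v := by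
  obtain ⟨lam, hlam, hA⟩ := hwin'
  have hlam0 : 0 < lam := lt_of_lt_of_le one_pos hlam.1
  have hΛ'1 : 1 ≤ Λ' := le_trans hwin.2.1 hΛ'.1
  have hΛ'pos : 0 < Λ' := lt_of_lt_of_le one_pos hΛ'1
  have hshi : 0 < shi := by
    have h := (window_straddles_one hwin).2
    have hl0 : 0 < lam₀ := lt_of_lt_of_le one_pos hwin.2.1
    by_contra hneg
    push Not at hneg
    have : lam₀ * shi ≤ 0 := mul_nonpos_of_nonneg_of_nonpos hl0.le hneg
    linarith
  have hX : Torus.NearIso ((1 / ν) • 𝔸) (lo / lam) (hi * lam) := by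
    have h := hA.smul (c := 1 / ν) (by positivity)
    exact nearIso_congr h (by field_simp) (by field_simp)
  have h1 : shi ≤ Λ' * (lo / lam) := by
    rw [mul_div_assoc', le_div_iff₀ hlam0]
    calc shi * lam ≤ shi * ΛV := mul_le_mul_of_nonneg_left hlam.2 hshi.le
      _ = ΛV * shi := mul_comm _ _
      _ ≤ Λ' * lo := hc1
  have h2 : hi * lam ≤ Λ' * slo := by
    calc hi * lam ≤ hi * ΛV := mul_le_mul_of_nonneg_left hlam.2 hhi
      _ = ΛV * hi := mul_comm _ _
      _ ≤ Λ' * slo := hc2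
  have hI : InInterval Sstar Λ' ((1 / ν) • 𝔸) := inInterval_of_nearIso hwin.1 hX hΛ'pos h1 h2
  have hN := nearIso_effTensorI (n := n) (c := c) hwin hμ hslo.le hν hc hodd hΛ' hI
  have hn1 : 1 ≤ (n:ℝ) := one_le_of_slowBand hℓ hK hν hsep
  have hn0 : (0:ℝ) < (n:ℝ) := lt_of_lt_of_le one_pos hn1
  have hlo' : 0 < (1 / (n:ℝ) ^ 2) * ((ν + c / ν) * (slo / (μ * Λ'))) := by
    have : 0 < ν + c / ν := by positivity
    have : 0 < μ * Λ' := mul_pos (lt_of_lt_of_le one_pos hμ) hΛ'pos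
    positivity
  exact FluidPDE.Torus.exists_isWeakTensorPassiveVectorOn_zero_carrier (by linarith) hN hlo'
    (memLp_two_of_memSobolev_one_complexify (memSobolev_one_singleMode ℓ p))
    (isWeaklyDivFree_singleMode ℓ hperp)

/-- **THE FAMILY ADAPTER (V_ν without existence ⇒ V_ν) from the interval window** — the F2 file's `cellLawVF_of_cellLawVNoExF` core with
`IntervalWindowClause` in place of `WindowClause`. -/
theorem slowVectorClauseF_of_noExF_interval {k : ℕ} {W : LatticeShear.LatticeWord k} {M : ℝ} {hM : 0 < M} {c : ℝ}
    {Φ : ℝ → T4 → T4} {Sstar : T4} {slo shi lam₀ Λ β : ℝ} {μ : ℝ → ℝ} {lo hi ΛV Λ' σ C ν₀ K : ℝ}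
    (hc : 0 < c) (hwin : ∀ ν, IntervalWindowClause (Φ ν) Sstar slo shi lam₀ Λ β (μ ν)) (hμ : ∀ ν, 1 ≤ μ ν) (hslo : 0 < slo)
    (hlo : 0 < lo) (hhi : 0 ≤ hi) (hK : 0 < K) (hΛ' : Λ' ∈ Set.Icc lam₀ Λ) (hc1 : ΛV * shi ≤ Λ' * lo) (hc2 : ΛV * hi ≤ Λ' * slo)
    (h : SlowVectorClauseNoExF W M hM c Φ lo hi ΛV β σ C ν₀ K) : SlowVectorClauseF W M hM c Φ lo hi ΛV β σ C ν₀ K := by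
  intro ν hν n 𝔸 hodd hwin' ℓ hℓ hsep p hp hperp T hT
  exact ⟨exists_effective_singleModeI (hwin ν) (hμ ν) hslo hlo hhi hΛ' hc1 hc2 hν.1 hc.le hK hodd hwin' hℓ hsep hperp hT,
    h ν hν n 𝔸 hodd hwin' ℓ hℓ hsep p hp hperp T hT⟩

/-- **CONSUMER FACT 2 (F2), sectorial × defect: ellipticity of the effective tensor.**  For `(1/ν)•𝔸` in the sector `τ ∈ [τlo, τhi]` and in the
interval of aspect `λ ∈ [λ₀, Λ]`, the effective cell tensor is `NearIso` with lower constant `(1/n²)(ν + c/ν)·slo/(μλ) > 0`. -/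
theorem nearIso_effTensorIS {Φν : T4 → T4} {Sstar : T4} {slo shi lam₀ Λ τlo τhi μ τ : ℝ}
    (hwin : SectorialIntervalWindowClause Φν Sstar slo shi lam₀ Λ τlo τhi μ) (hμ : 1 ≤ μ) (hslo : 0 ≤ slo)
    (hτ : τ ∈ Set.Icc τlo τhi) {ν c : ℝ} (hν : 0 < ν) (hc : 0 ≤ c) {n : ℕ} {𝔸 : T4}
    (hsec : OddSectorial ((1 / ν) • 𝔸) τ)
    {lam : ℝ} (hlam : lam ∈ Set.Icc lam₀ Λ) (hA : InInterval Sstar lam ((1 / ν) • 𝔸)) :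
    Torus.NearIso ((1 / (n:ℝ) ^ 2) • (𝔸 + (c / ν) • Φν ((1 / ν) • 𝔸)))
      ((1 / (n:ℝ) ^ 2) * ((ν + c / ν) * (slo / (μ * lam)))) ((1 / (n:ℝ) ^ 2) * ((ν + c / ν) * (shi * (μ * lam)))) := by
  obtain ⟨hstar, hlam₀, _, hstep⟩ := hwin
  have hlam1 : 1 ≤ lam := le_trans hlam₀ hlam.1
  have hlampos : 0 < lam := lt_of_lt_of_le one_pos hlam1
  have hμlam : 1 ≤ μ * lam := one_le_mul_of_one_le_of_one_le hμ hlam1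
  have hle : lam ≤ μ * lam := le_mul_of_one_le_left hlampos.le hμ
  obtain ⟨_, hΦi⟩ := hstep τ hτ lam hlam _ hsec hA
  have hpos : TransNonneg Sstar := transNonneg_of_nearIso hstar hslo
  have hX : Torus.NearIso ((1 / ν) • 𝔸) (slo / (μ * lam)) (shi * (μ * lam)) :=
    InInterval.nearIso hμlam hstar (hA.mono hpos hlampos hle)
  have hΦ : Torus.NearIso (Φν ((1 / ν) • 𝔸)) (slo / (μ * lam)) (shi * (μ * lam)) := InInterval.nearIso hμlam hstar hΦi
  have hA𝔸 : Torus.NearIso 𝔸 (ν * (slo / (μ * lam))) (ν * (shi * (μ * lam))) := by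
    have h := hX.smul (c := ν) hν.le
    rwa [smul_smul, mul_one_div_cancel hν.ne', one_smul] at h
  have hcν : 0 ≤ c / ν := div_nonneg hc hν.le
  have hsum := hA𝔸.add (hΦ.smul hcν)
  have hn : (0:ℝ) ≤ 1 / (n:ℝ) ^ 2 := by positivity
  have h := hsum.smul hn
  exact nearIso_congr h (by ring) (by ring)

/-- **Existence of the effective single-mode solution, sectorial × defect** (Lions): (V)'s ABSOLUTE odd hypothesis `OddSmall 𝔸 (ν·β)` and its band
`NearIso 𝔸 (ν·lo/λ) (ν·hi·λ)`, `λ ≤ ΛV`, are converted to the sector `β·ΛV/lo` (which must lie in `[τlo, τhi]`) and to the interval of aspect `Λ'`.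
[cite: LionsMagenes1972, Chap. 3 Thm. 1.1] -/
theorem exists_effective_singleModeIS {Φν : T4 → T4} {Sstar : T4} {slo shi lam₀ Λ τlo τhi β μ : ℝ}
    (hwin : SectorialIntervalWindowClause Φν Sstar slo shi lam₀ Λ τlo τhi μ) (hμ : 1 ≤ μ) (hslo : 0 < slo)
    {lo hi ΛV Λ' : ℝ} (hlo : 0 < lo) (hhi : 0 ≤ hi) (hΛ' : Λ' ∈ Set.Icc lam₀ Λ)
    (hc1 : ΛV * shi ≤ Λ' * lo) (hc2 : ΛV * hi ≤ Λ' * slo) (hβ : 0 ≤ β) (hτF : β * ΛV / lo ∈ Set.Icc τlo τhi)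
    {ν c K : ℝ} (hν : 0 < ν) (hc : 0 ≤ c) (hK : 0 < K) {n : ℕ}
    {𝔸 : T4} (hodd : Torus.OddSmall 𝔸 (ν * β))
    (hwin' : ∃ lam ∈ Set.Icc (1:ℝ) ΛV, Torus.NearIso 𝔸 (ν * (lo / lam)) (ν * (hi * lam)))
    {ℓ : Fin 3 → ℤ} (hℓ : ℓ ≠ 0) (hsep : ‖Torus.latticeVec ℓ‖ * (⌈K / ν⌉₊ : ℝ) ≤ n)
    {p : EuclideanSpace ℝ (Fin 3)} (hperp : ⟪p, Torus.latticeVec ℓ⟫_ℝ = 0) {T : ℝ} (hT : 0 < T) :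
    ∃ v : ℝ → VF, Torus.IsWeakTensorPassiveVectorOn 0 (2 * T) ((1 / (n:ℝ) ^ 2) • (𝔸 + (c / ν) • Φν ((1 / ν) • 𝔸))) (fun _ _ => 0)
      (fun x => (UnitAddTorus.mFourier ℓ x).re • p) v := by
  obtain ⟨lam, hlam, hA⟩ := hwin'
  have hlam0 : 0 < lam := lt_of_lt_of_le one_pos hlam.1
  have hΛ'1 : 1 ≤ Λ' := le_trans hwin.2.1 hΛ'.1
  have hΛ'pos : 0 < Λ' := lt_of_lt_of_le one_pos hΛ'1
  have hshi : 0 < shi := by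
    -- `slo ≤ shi` at the transverse pair `k = e₀`, `p = e₁`
    set k : Fin 3 → ℝ := fun i => if i = 0 then 1 else 0 with hk
    set q : Fin 3 → ℝ := fun i => if i = 1 then 1 else 0 with hq
    have hkq : ∑ i, q i * k i = 0 := by simp [hk, hq]
    have hQ : (∑ a, k a ^ 2) * (∑ i, q i ^ 2) = 1 := by simp [hk, hq]
    obtain ⟨hl, hh⟩ := hwin.1 k q hkq
    rw [hQ] at hl hh
    linarith
  have hX : Torus.NearIso ((1 / ν) • 𝔸) (lo / lam) (hi * lam) := by
    have h := hA.smul (c := 1 / ν) (by positivity)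
    exact nearIso_congr h (by field_simp) (by field_simp)
  have hsec : OddSectorial ((1 / ν) • 𝔸) (β * ΛV / lo) := by
    have hodd' : Torus.OddSmall ((1 / ν) • 𝔸) β := by
      have h := hodd.smul (1 / ν)
      exact oddSmall_congr h (by field_simp)
    have h0 := oddSectorial_of_oddSmall hodd' hX (div_pos hlo hlam0)
    refine h0.mono (transNonneg_of_nearIso hX (div_nonneg hlo.le hlam0.le)) (div_nonneg hβ (div_nonneg hlo.le hlam0.le)) ?_
    rw [div_div_eq_mul_div, div_le_div_iff_of_pos_right hlo]
    exact mul_le_mul_of_nonneg_left hlam.2 hβ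
  have h1 : shi ≤ Λ' * (lo / lam) := by
    rw [mul_div_assoc', le_div_iff₀ hlam0]
    calc shi * lam ≤ shi * ΛV := mul_le_mul_of_nonneg_left hlam.2 hshi.le
      _ = ΛV * shi := mul_comm _ _
      _ ≤ Λ' * lo := hc1
  have h2 : hi * lam ≤ Λ' * slo := by
    calc hi * lam ≤ hi * ΛV := mul_le_mul_of_nonneg_left hlam.2 hhi
      _ = ΛV * hi := mul_comm _ _
      _ ≤ Λ' * slo := hc2
  have hI : InInterval Sstar Λ' ((1 / ν) • 𝔸) := inInterval_of_nearIso hwin.1 hX hΛ'pos h1 h2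
  have hN := nearIso_effTensorIS (n := n) (c := c) hwin hμ hslo.le hτF hν hc hsec hΛ' hI
  have hn1 : 1 ≤ (n:ℝ) := one_le_of_slowBand hℓ hK hν hsep
  have hlo' : 0 < (1 / (n:ℝ) ^ 2) * ((ν + c / ν) * (slo / (μ * Λ'))) := by
    have : 0 < ν + c / ν := by positivity
    have : 0 < μ * Λ' := mul_pos (lt_of_lt_of_le one_pos hμ) hΛ'pos
    positivity
  exact FluidPDE.Torus.exists_isWeakTensorPassiveVectorOn_zero_carrier (by linarith) hN hlo'
    (memLp_two_of_memSobolev_one_complexify (memSobolev_one_singleMode ℓ p))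
    (isWeaklyDivFree_singleMode ℓ hperp)

/-- **THE FAMILY ADAPTER (V_ν without existence ⇒ V_ν), sectorial × defect** — (V)'s text byte-identical. -/
theorem slowVectorClauseF_of_noExF_intervalS {k : ℕ} {W : LatticeShear.LatticeWord k} {M : ℝ} {hM : 0 < M} {c : ℝ}
    {Φ : ℝ → T4 → T4} {Sstar : T4} {slo shi lam₀ Λ τlo τhi β : ℝ} {μ : ℝ → ℝ} {lo hi ΛV Λ' σ C ν₀ K : ℝ}
    (hc : 0 < c) (hwin : ∀ ν, SectorialIntervalWindowClause (Φ ν) Sstar slo shi lam₀ Λ τlo τhi (μ ν)) (hμ : ∀ ν, 1 ≤ μ ν) (hslo : 0 < slo)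
    (hlo : 0 < lo) (hhi : 0 ≤ hi) (hK : 0 < K) (hΛ' : Λ' ∈ Set.Icc lam₀ Λ) (hc1 : ΛV * shi ≤ Λ' * lo) (hc2 : ΛV * hi ≤ Λ' * slo)
    (hβ : 0 ≤ β) (hτF : β * ΛV / lo ∈ Set.Icc τlo τhi)
    (h : SlowVectorClauseNoExF W M hM c Φ lo hi ΛV β σ C ν₀ K) : SlowVectorClauseF W M hM c Φ lo hi ΛV β σ C ν₀ K := by
  intro ν hν n 𝔸 hodd hwin' ℓ hℓ hsep p hp hperp T hT
  exact ⟨exists_effective_singleModeIS (hwin ν) (hμ ν) hslo hlo hhi hΛ' hc1 hc2 hβ hτF hν.1 hc.le hK hodd hwin' hℓ hsep hperp hT,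
    h ν hν n 𝔸 hodd hwin' ℓ hℓ hsep p hp hperp T hT⟩

/-- The adapter through the package. -/
theorem slowVectorClauseF_of_noExF_familyS {k : ℕ} {W : LatticeShear.LatticeWord k} {M : ℝ} {hM : 0 < M} {c : ℝ}
    {Φ : ℝ → T4 → T4} {μ : ℝ → ℝ} {Sstar : T4} {slo shi lam₀ Λ Λc Λ' τlo τhi τc β lo hi ΛV σ C ν₀ K : ℝ}
    (hc : 0 < c) (hlo : 0 < lo) (hhi : 0 ≤ hi) (hK : 0 < K) (hβ : 0 ≤ β)
    (hWF : SectorialIntervalWindowFamily Φ μ Sstar slo shi lam₀ Λ Λc Λ' τlo τhi τc β lo hi ΛV)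
    (h : SlowVectorClauseNoExF W M hM c Φ lo hi ΛV β σ C ν₀ K) : SlowVectorClauseF W M hM c Φ lo hi ΛV β σ C ν₀ K := by
  obtain ⟨hwin, hμ, _, hslo, _, _, _, _, hΛ', hc1, hc2, _, _, _, hτF⟩ := hWF
  exact slowVectorClauseF_of_noExF_intervalS hc hwin hμ hslo hlo hhi hK hΛ' hc1 hc2 hβ hτF h

end

end Summit.AnomalousDissipation.AnomalousDissipation.Theorems.SolenoidalFractalHomogenisation.LagrangianStep
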